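import Summits.BirchSwinnertonDyer.BirchSwinnertonDyer.Theorems.SignedLowerHalvesSmallImageLowerHalfBothSignsRttD2SeqJ3HStrict
import Literature.NumberTheory.GaloisRepresentations.ContinuousShapiroOpenCoinducedMackeyVanishing
import Literature.NumberTheory.GaloisRepresentations.ContinuousShapiroOpenCoinducedLayerChange
import Literature.NumberTheory.GaloisRepresentations.ContinuousShapiroLiftFunctor
import Literature.NumberTheory.GaloisRepresentations.AbsGaloisGroupCompact
import HarnessLib

/-!
# Route `SignedLowerHalves`, crux L `SmallImageLowerHalfBothSigns` (stmt-BirchSwinnertonDyer-23599), line `rtt_w3` v23 — stub S3β (`stub_junctionPT_ns`, row J4′,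
# Poitou–Tate half), brick T1-a: THE SEMILOCAL LAYER GROUPS AT A DEPLETED PLACE `w` WITH COINDUCED COEFFICIENTS
# `Lloc_w(n,k) = H¹(Γ_{K_w}, Maps(Γ_K ⧸ U_n, X_k))` and the semilocalisation `sloc_{w,n,k} = res_w ∘ Sh_{U_n} ∘ infl_n` of honda's layer classes

WIDTH seat `bsd-line-slh-p3-w3` g25 under LEAD `cruxlead-stmt-BirchSwinnertonDyer-23599` g13 (cell `bsd-ssimc`); helper `--supports stmt-BirchSwinnertonDyer-23599`
(design memo `Lines/rtt_w3-DESIGN-S3beta-w3-g25.md`, §2 T1-a). DEFINITIONS WITH BODIES + THEOREMS; no named fact, no instance, no `sorry`.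
WHY. The compact five-term sequence behind S3β (`B′ ↪ I.H → Hloc → coker gX ↠ Y′`) needs the SEMILOCAL module at the places `w ∈ S₀K`, which SPLIT in the cyclotomic tower
(`w ∤ p`): level `n` has several places above `w` (the double cosets `Γ_{K_w} \ Γ_K / U_n`), and the corestrictions mix them. With COINDUCED coefficients the level-`(n,k)` semilocal
group at `w` is ONE cohomology group of the base local Galois group, `H¹(Γ_{K_w}, Maps(Γ_K ⧸ U_n, X_k)|_{res_w}) = ⊕_{w′ ∣ w in K_n} H¹(K_{n,w′}, X_k)` (Mackey–Shapiro), and the four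
transitions (corestriction, reduction, `𝒪`-scalars, conjugation) are plain functoriality in the coefficient module (`coindFinSum`, `coindFinMap`, `rTransHom`) — no orbit bookkeeping;
moreover Poitou–Tate at `S₀K` for honda's layer classes becomes the tree's base-field `SelmerComplement` for the `Γ_K`-module `Maps(Γ_K ⧸ U_n, X_k)` (next bricks).
HONEST FRAMING: bookkeeping; nothing about S3β, E2, crux L or BSD is proved; all remain OPEN and are proved for NO curve.

* §1 `coeffHomK` — a `Γ_K`-equivariant coefficient morphism `X_k → X_{k′}` from an equivariant additive map of honda's carriers (reduction, `𝒪`-scalars), and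
  `cohomologyMap_coeffHomK_inflNK` — the inflation `infl_n` (R4, p794993-lineage) commutes with the change of coefficients.
* §2 `semilocRep`/`semilocCoh w n k i` — the semilocal layer groups; ★ `semilocNK w n k := res_w ∘ sh_{U_n}⁻¹ ∘ infl_n : H¹(G_P(K_n), X_k) →+ Lloc_w(n,k)` (the tree's canonical
  Shapiro isomorphism `shapiroCoindFinAddEquiv`), and `semilocNK_eq_map_shapiroLift` (= the representative-based Shapiro lift of g23's H6, any representatives).
* §3 LAWS: ★ `semilocNK_cycLayerConjO` (`sloc ∘ conj_γ = H¹(R_{γU_n}) ∘ sloc`: the `Λ`-variable acts on `Lloc` by right translation), ★ `semilocNK_levelMapHomO` (`sloc ∘ H¹(f) =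
  H¹(Maps(f)) ∘ sloc` for every equivariant coefficient map: reduction `semilocNK_cycLayerRedO`, scalars `semilocNK_cycLayerScalarO`), ★★ `semilocNK_eq_zero_iff` (`sloc_{w,n,k} y = 0 ↔`
  every conjugate localisation `loc_{n,w}(conj_δ y)` vanishes — the tree's semilocal vanishing criterion `map_restrict_eq_zero_iff_forall_conjMap_one`), hence ★★
  `mem_strictLevel_iff_forall_semilocNK_cycCoresLE_eq_zero` (g22's strict set = the classes all of whose semilocalisations at `S₀`, at all levels `n′ ≤ n`, vanish).
* §4 ★ `semilocNK_cycLayerCoresO` (`sloc ∘ cor = H¹(coindFinSum) ∘ sloc`, needs `N_P ≤ U_{n+1}`) and ★★ `mem_strictLevel_iff_forall_semilocNK_eq_zero` (`strictLevel … n k = ⋂_{w∈S₀} ker sloc_{w,n,k}`: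
  the level-`(n,k)` kernel of the semilocalisation IS g22's strict set — the levelwise form of `ker(loc_{S₀K}) = B′`).
References: [NeukirchSchmidtWingberg2008] I §5 (1.5.6)–(1.5.7), I §6 (1.6.4)–(1.6.5), (8.6.2)–(8.6.3); [SerreLocalFields1979] VII §5–§6; [Brown1982] III §5 (5.6)(b); [Rubin2000] App. B.
-/

set_option autoImplicit false
set_option linter.dupNamespace false -- D-0017: single-problem summit, the namespace repeats the problem name by design
noncomputable section

open scoped Classical
open NumberField IsDedekindDomain Field CategoryTheory Function

namespace Summit.BirchSwinnertonDyer.BirchSwinnertonDyer.Theorems.SmallImageRttD2Seq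

open Literature.NumberTheory.EllipticCurves Literature.NumberTheory.GaloisRepresentations
  Literature.NumberTheory.ComplexMultiplication.EllipticUnits.JohnsonLeungKings2011
  Summit.BirchSwinnertonDyer.BirchSwinnertonDyer.Theorems.SmallImageRttD2J1

section Semiloc

variable {K : Type} [Field K] [NumberField K] {p : ℕ} [Fact p.Prime] (S : Set (PadicAlgCl p)) (κ : ZpExtension K p)
  (θ' : absoluteGaloisGroup K →ₜ* (padicCoeffIntegers S)ˣ) (P : Set (HeightOneSpectrum (𝓞 K))) (w : HeightOneSpectrum (𝓞 K))

/-! ## §1. Equivariant coefficient morphisms at the `Γ_K`-level and the inflation -/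

/-- **A `Γ_K`-equivariant morphism of honda's coefficient modules `X_k → X_{k′}`** induced by an equivariant additive map of the carriers `𝒪 ⊗ μ_{p^k} ⊗ θ′ → 𝒪 ⊗ μ_{p^{k′}} ⊗ θ′`
(descended to the `N_P`-invariants by `coeffMapO`; the `Γ_K`-level twin of `levelMapHomO`). [cite: JohnsonLeungKings2011, Def. 4.2] [cite: Kato2004Asterisque, §8.2 (p. 180)] -/
def coeffHomK {k k' : ℕ} (f : OMuCarrier K S (p ^ k) →+ OMuCarrier K S (p ^ k'))
    (hf : ∀ (σ : absoluteGaloisGroup K) (x : OMuCarrier K S (p ^ k)), f (muTwistO S θ' k σ x) = muTwistO S θ' k' σ (f x)) :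
    (coeffRepK S θ' P k).toTopRep ⟶ (coeffRepK S θ' P k').toTopRep :=
  TopRep.ofHom ⟨⟨coeffMapO S P θ' f hf, continuous_of_discreteTopology⟩, fun g ↦ by
    ext x
    exact congrArg Subtype.val (Subtype.ext (hf g (x : OMuCarrier K S (p ^ k))) :
      coeffMapO S P θ' f hf ((coeffRepK S θ' P k) g x) = (coeffRepK S θ' P k') g (coeffMapO S P θ' f hf x))⟩

omit [NumberField K] in
/-- Values of `coeffHomK`: `f` on vectors. [folklore] -/
theorem coeffHomK_hom_apply_coe {k k' : ℕ} (f : OMuCarrier K S (p ^ k) →+ OMuCarrier K S (p ^ k'))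
    (hf : ∀ (σ : absoluteGaloisGroup K) (x : OMuCarrier K S (p ^ k)), f (muTwistO S θ' k σ x) = muTwistO S θ' k' σ (f x))
    (x : (coeffRepK S θ' P k).toTopRep) :
    (((coeffHomK S θ' P f hf).hom x : (coeffRepK S θ' P k').toTopRep) : OMuCarrier K S (p ^ k')) = f (x : OMuCarrier K S (p ^ k)) :=
  rfl

omit [NumberField K] in
/-- ★ **The inflation commutes with every change of coefficients**: `H¹(f|_{U_n}) (infl_n y) = infl_n (H¹(f) y)` — both are the map of the pair `(U_n → (U_n)_P, v ↦ f v)`.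
[cite: NeukirchSchmidtWingberg2008, I §5] [cite: Kato2004Asterisque, §8.2 (p. 180)] -/
theorem cohomologyMap_coeffHomK_inflNK {k k' : ℕ} (f : OMuCarrier K S (p ^ k) →+ OMuCarrier K S (p ^ k'))
    (hf : ∀ (σ : absoluteGaloisGroup K) (x : OMuCarrier K S (p ^ k)), f (muTwistO S θ' k σ x) = muTwistO S θ' k' σ (f x)) (n : ℕ)
    (y : cycLayerCohO S κ θ' P n k 1) :
    cohomologyMap (subgroupRepMap (coeffHomK S θ' P f hf) (κ.layerSubgroup n)) 1 (inflNK S κ θ' P n k y) =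
      inflNK S κ θ' P n k' ((ContinuousCohomology.map (ContinuousMonoidHom.id _) (levelMapHomO S P θ' (κ.layerSubgroup n) f hf) 1).hom y) := by
  rw [inflNK_apply, inflNK_apply]
  have e1 := map_comp_apply_of (layerQuotHom κ P n) (ContinuousMonoidHom.id _) (layerQuotHom κ P n) (fun _ ↦ rfl)
      (inflMod S κ θ' P n k) (resIdHom (subgroupRepMap (coeffHomK S θ' P f hf) (κ.layerSubgroup n)))
      (TopRep.ofHom ⟨⟨coeffMapO S P θ' f hf, continuous_of_discreteTopology⟩, fun u ↦ by
        ext x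
        exact congrArg Subtype.val (Subtype.ext (hf _ (x : OMuCarrier K S (p ^ k))) :
          coeffMapO S P θ' f hf ((coeffRepK S θ' P k) (u : absoluteGaloisGroup K) x) =
            (coeffRepK S θ' P k') (u : absoluteGaloisGroup K) (coeffMapO S P θ' f hf x))⟩) (fun _ ↦ rfl) 1 y
  have e2 := map_comp_apply_of (ContinuousMonoidHom.id _) (layerQuotHom κ P n) (layerQuotHom κ P n) (fun _ ↦ rfl)
      (levelMapHomO S P θ' (κ.layerSubgroup n) f hf) (inflMod S κ θ' P n k')
      (TopRep.ofHom ⟨⟨coeffMapO S P θ' f hf, continuous_of_discreteTopology⟩, fun u ↦ by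
        ext x
        exact congrArg Subtype.val (Subtype.ext (hf _ (x : OMuCarrier K S (p ^ k))) :
          coeffMapO S P θ' f hf ((coeffRepK S θ' P k) (u : absoluteGaloisGroup K) x) =
            (coeffRepK S θ' P k') (u : absoluteGaloisGroup K) (coeffMapO S P θ' f hf x))⟩) (fun _ ↦ rfl) 1 y
  exact e1.symm.trans e2

/-! ## §2. The semilocal layer groups and the semilocalisation -/

/-- **The semilocal coefficients at `w` of level `(n, k)`**: the coinduced `Γ_K`-module `Maps(Γ_K ⧸ U_n, X_k)` restricted along `res_w : Γ_{K_w} → Γ_K`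
(`= ⊕_{w′ ∣ w in K_n} Ind X_k` by Mackey). [cite: NeukirchSchmidtWingberg2008, I §5 (1.5.6)–(1.5.7), I §6 (1.6.4)] [cite: Brown1982, III §5 (5.6)(b)] -/
abbrev semilocRep (n k : ℕ) : TopRep ℤ (absoluteGaloisGroup (w.adicCompletion K)) :=
  TopRep.res (resGalOfEmb (closureEmb (K := K) (w.adicCompletion K)) : absoluteGaloisGroup (w.adicCompletion K) →* absoluteGaloisGroup K)
    (coindFin.{0, 0} (coeffRepK S θ' P k).toTopRep (κ.layerSubgroup n))

/-- **The semilocal layer group `Lloc_w(n,k) = H^i(Γ_{K_w}, Maps(Γ_K ⧸ U_n, X_k))` (`= ⊕_{w′ ∣ w in K_n} H^i(K_{n,w′}, X_k)`)**: the level-`(n,k)` term at `w` of the semilocal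
Iwasawa cohomology `⊕_{w′ ∣ w} 𝐇^i_{Iw}`. [cite: NeukirchSchmidtWingberg2008, I §6 (1.6.4)–(1.6.5), (8.6.2)] [cite: Rubin2000, App. B.3] -/
abbrev semilocCoh (n k i : ℕ) : Type :=
  (continuousCohomology i (semilocRep S κ θ' P w n k) : TopModuleCat ℤ)

/-- **The restriction `res_w : H^i(Γ_K, Maps(Γ_K ⧸ U_n, X_k)) → Lloc_w(n,k)`** along the decomposition group of the chosen embedding. [cite: NeukirchSchmidtWingberg2008, (8.6.2)] -/
def semilocRes (n k i : ℕ) :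
    (continuousCohomology i (coindFin.{0, 0} (coeffRepK S θ' P k).toTopRep (κ.layerSubgroup n)) : Type) →+ semilocCoh S κ θ' P w n k i :=
  (ContinuousCohomology.map (resGalOfEmb (closureEmb (K := K) (w.adicCompletion K))) (𝟙 (semilocRep S κ θ' P w n k)) i).hom.toLinearMap.toAddMonoidHom

/-- Unfolding `semilocRes`. [folklore] -/
theorem semilocRes_apply (n k i : ℕ) (x : continuousCohomology i (coindFin.{0, 0} (coeffRepK S θ' P k).toTopRep (κ.layerSubgroup n))) :
    semilocRes S κ θ' P w n k i x =
      (ContinuousCohomology.map (resGalOfEmb (closureEmb (K := K) (w.adicCompletion K))) (𝟙 (semilocRep S κ θ' P w n k)) i).hom x :=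
  rfl

/-- `res_w` is natural in the coefficient module: `res_w ∘ H^i(η) = H^i(η|_{res_w}) ∘ res_w`. [cite: SerreGaloisCohomology1997, I §2.4] -/
theorem semilocRes_cohomologyMap {n n' k k' : ℕ} (i : ℕ)
    (η : coindFin.{0, 0} (coeffRepK S θ' P k).toTopRep (κ.layerSubgroup n) ⟶ coindFin.{0, 0} (coeffRepK S θ' P k').toTopRep (κ.layerSubgroup n'))
    (x : continuousCohomology i (coindFin.{0, 0} (coeffRepK S θ' P k).toTopRep (κ.layerSubgroup n))) :
    semilocRes S κ θ' P w n' k' i (cohomologyMap η i x) =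
      cohomologyMap ((TopRep.resFunctor (resGalOfEmb (closureEmb (K := K) (w.adicCompletion K)) :
        absoluteGaloisGroup (w.adicCompletion K) →* absoluteGaloisGroup K)).map η) i (semilocRes S κ θ' P w n k i x) := by
  rw [semilocRes_apply, semilocRes_apply, map_cohomologyMap_eq_map, Category.comp_id, cohomologyMap_map_id_eq_map]

/-- ★ **The semilocalisation `sloc_{w,n,k} = res_w ∘ sh_{U_n}⁻¹ ∘ infl_n : H¹(G_P(K_n), X_k) →+ Lloc_w(n,k)`**: inflate honda's layer class to `U_n ≤ Γ_K` (R4 `inflNK`), move it to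
`H¹(Γ_K, Maps(Γ_K ⧸ U_n, X_k))` by the canonical Shapiro isomorphism (`shapiroCoindFinAddEquiv`), restrict to `Γ_{K_w}`. Under Mackey it is the vector of ALL localisations of the class at the
places of `K_n` above `w`. [cite: NeukirchSchmidtWingberg2008, I §6 (1.6.4)–(1.6.5), (8.6.2)] [cite: Rubin2000, App. B.3] -/
def semilocNK (n k : ℕ) : cycLayerCohO S κ θ' P n k 1 →+ semilocCoh S κ θ' P w n k 1 :=
  (semilocRes S κ θ' P w n k 1).comp
    ((((coeffRepK S θ' P k).shapiroCoindFinAddEquiv (κ.layerSubgroup n) (κ.isOpen_layerSubgroup n) 1).symm.toAddMonoidHom).comp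
      (inflNK S κ θ' P n k))

/-- Unfolding `semilocNK`. [folklore] -/
theorem semilocNK_apply (n k : ℕ) (y : cycLayerCohO S κ θ' P n k 1) :
    semilocNK S κ θ' P w n k y =
      semilocRes S κ θ' P w n k 1 (((coeffRepK S θ' P k).shapiroCoindFinAddEquiv (κ.layerSubgroup n) (κ.isOpen_layerSubgroup n) 1).symm (inflNK S κ θ' P n k y)) :=
  rfl

/-- **The canonical Shapiro isomorphism inverts the representative-based Shapiro lift**: `sh (Sh a) = a` (`sh = H¹(U ↪ Γ, ev₁)` and `ev₁ ∘ Sh = id` on cocycles).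
[cite: NeukirchSchmidtWingberg2008, I §6 Prop. (1.6.4)] -/
theorem shapiroCoindFinAddEquiv_shapiroLift (n k : ℕ) {s : absoluteGaloisGroup K ⧸ κ.layerSubgroup n → absoluteGaloisGroup K}
    (hs : ∀ x, (s x : absoluteGaloisGroup K ⧸ κ.layerSubgroup n) = x) (hs1 : s ((1 : absoluteGaloisGroup K) : absoluteGaloisGroup K ⧸ κ.layerSubgroup n) = 1)
    (a : continuousCohomology 1 (subgroupRep (coeffRepK S θ' P k).toTopRep (κ.layerSubgroup n))) :
    (coeffRepK S θ' P k).shapiroCoindFinAddEquiv (κ.layerSubgroup n) (κ.isOpen_layerSubgroup n) 1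
        (shapiroLift (coeffRepK S θ' P k).toTopRep (κ.layerSubgroup n) (κ.isOpen_layerSubgroup n) hs hs1 a) = a := by
  obtain ⟨f, rfl⟩ := oneCocycleClass_surjective _ a
  rw [shapiroLift_oneCocycleClass, ContinuousRep.shapiroCoindFinAddEquiv_apply, map_oneCocycleClass]
  have h : contOneCocycles.pullback (Literature.NumberTheory.GaloisRepresentations.subgroupIncl (κ.layerSubgroup n)) (coindFinEvalAtOne (coeffRepK S θ' P k).toTopRep (κ.layerSubgroup n))
      (shapiroCocycle (coeffRepK S θ' P k).toTopRep (κ.layerSubgroup n) (κ.isOpen_layerSubgroup n) hs f) =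
      evalOne (coeffRepK S θ' P k).toTopRep (κ.layerSubgroup n) (shapiroCocycle (coeffRepK S θ' P k).toTopRep (κ.layerSubgroup n) (κ.isOpen_layerSubgroup n) hs f) :=
    Subtype.ext (ContinuousMap.ext fun _ ↦ rfl)
  rw [h, evalOne_shapiroCocycle _ _ _ hs hs1]

/-- **`sloc` in the representative-based currency of H6**: `sloc_{w,n,k} y = res_w (Sh_{U_n} (infl_n y))` for EVERY system of representatives (so g23's
`mem_strictLevel_of_map_shapiroLift_eq_zero` and the Mackey lemmas stated with `shapiroLift` apply to `sloc`). [cite: NeukirchSchmidtWingberg2008, I §6 Prop. (1.6.4)] -/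
theorem semilocNK_eq_map_shapiroLift (n k : ℕ) {s : absoluteGaloisGroup K ⧸ κ.layerSubgroup n → absoluteGaloisGroup K}
    (hs : ∀ x, (s x : absoluteGaloisGroup K ⧸ κ.layerSubgroup n) = x) (hs1 : s ((1 : absoluteGaloisGroup K) : absoluteGaloisGroup K ⧸ κ.layerSubgroup n) = 1)
    (y : cycLayerCohO S κ θ' P n k 1) :
    semilocNK S κ θ' P w n k y =
      (ContinuousCohomology.map (resGalOfEmb (closureEmb (K := K) (w.adicCompletion K))) (𝟙 (semilocRep S κ θ' P w n k)) 1).hom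
        (shapiroLift (coeffRepK S θ' P k).toTopRep (κ.layerSubgroup n) (κ.isOpen_layerSubgroup n) hs hs1 (inflNK S κ θ' P n k y)) := by
  rw [semilocNK_apply, semilocRes_apply]
  congr 1
  rw [AddEquiv.symm_apply_eq, shapiroCoindFinAddEquiv_shapiroLift]

/-! ## §3. Laws -/

/-- ★ **`sloc ∘ conj_γ = H¹(R_{γ U_n}) ∘ sloc`**: the conjugation action of `γ ∈ Γ_K` on honda's layer classes (`cycLayerConjO`) becomes the RIGHT TRANSLATION by the coset `γ U_n`
on the coinduced coefficients (`rTransHom`; `sh ∘ H¹(R_{γU}) = conj_γ ∘ sh`, `infl ∘ conj = conj ∘ infl`). This is how the `Λ`-variable `T = γ − 1` acts on `Lloc_w`.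
[cite: SerreLocalFields1979, VII §5] [cite: NeukirchSchmidtWingberg2008, I §6 Prop. (1.6.5)] -/
theorem semilocNK_cycLayerConjO (n k : ℕ) (γ : absoluteGaloisGroup K) (y : cycLayerCohO S κ θ' P n k 1) :
    semilocNK S κ θ' P w n k (cycLayerConjO S κ θ' P n k 1 γ y) =
      cohomologyMap ((TopRep.resFunctor (resGalOfEmb (closureEmb (K := K) (w.adicCompletion K)) :
          absoluteGaloisGroup (w.adicCompletion K) →* absoluteGaloisGroup K)).map
        (rTransHom (coeffRepK S θ' P k).toTopRep (κ.layerSubgroup n) (γ : absoluteGaloisGroup K ⧸ κ.layerSubgroup n))) 1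
        (semilocNK S κ θ' P w n k y) := by
  rw [semilocNK_apply, semilocNK_apply, ← semilocRes_cohomologyMap]
  congr 1
  rw [AddEquiv.symm_apply_eq, ContinuousRep.shapiroCoindFinAddEquiv_rTransHom_one, AddEquiv.apply_symm_apply, conjMap_inflNK]

/-- ★ **`sloc ∘ H¹(f) = H¹(Maps(f)|_{res_w}) ∘ sloc`** for every equivariant change of coefficients `f : X_k → X_{k′}` (Shapiro is natural in the coefficients,
`shapiroCoindFinAddEquiv_cohomologyMap_coindFinMap`; the inflation commutes with `f`, §1). [cite: NeukirchSchmidtWingberg2008, I §6 Prop. (1.6.4)] [cite: Kato2004Asterisque, §8.2 (p. 180)] -/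
theorem semilocNK_levelMapHomO {k k' : ℕ} (f : OMuCarrier K S (p ^ k) →+ OMuCarrier K S (p ^ k'))
    (hf : ∀ (σ : absoluteGaloisGroup K) (x : OMuCarrier K S (p ^ k)), f (muTwistO S θ' k σ x) = muTwistO S θ' k' σ (f x)) (n : ℕ)
    (y : cycLayerCohO S κ θ' P n k 1) :
    semilocNK S κ θ' P w n k' ((ContinuousCohomology.map (ContinuousMonoidHom.id _) (levelMapHomO S P θ' (κ.layerSubgroup n) f hf) 1).hom y) =
      cohomologyMap ((TopRep.resFunctor (resGalOfEmb (closureEmb (K := K) (w.adicCompletion K)) :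
          absoluteGaloisGroup (w.adicCompletion K) →* absoluteGaloisGroup K)).map
        (coindFinMap (coeffHomK S θ' P f hf) (κ.layerSubgroup n))) 1 (semilocNK S κ θ' P w n k y) := by
  rw [semilocNK_apply, semilocNK_apply, ← semilocRes_cohomologyMap]
  congr 1
  rw [AddEquiv.symm_apply_eq, ContinuousRep.shapiroCoindFinAddEquiv_cohomologyMap_coindFinMap, AddEquiv.apply_symm_apply,
    cohomologyMap_coeffHomK_inflNK]

/-- `sloc ∘ red = H¹(Maps(red)) ∘ sloc` (reduction `𝒪 ⊗ μ_{p^{k+1}} → 𝒪 ⊗ μ_{p^k}`). [cite: Kato2004Asterisque, §8.2 (p. 180)] -/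
theorem semilocNK_cycLayerRedO (n k : ℕ) (y : cycLayerCohO S κ θ' P n (k + 1) 1) :
    semilocNK S κ θ' P w n k (cycLayerRedO S κ θ' P n k 1 y) =
      cohomologyMap ((TopRep.resFunctor (resGalOfEmb (closureEmb (K := K) (w.adicCompletion K)) :
          absoluteGaloisGroup (w.adicCompletion K) →* absoluteGaloisGroup K)).map
        (coindFinMap (coeffHomK S θ' P (oMuRed S k) (oMuRed_muTwistO S θ' k)) (κ.layerSubgroup n))) 1 (semilocNK S κ θ' P w n (k + 1) y) :=
  semilocNK_levelMapHomO S κ θ' P w (oMuRed S k) (oMuRed_muTwistO S θ' k) n y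

/-- `sloc ∘ H¹(c ⊗ id) = H¹(Maps(c ⊗ id)) ∘ sloc` (`𝒪`-scalars). [cite: JohnsonLeungKings2011, §4.1 Def. 4.1] -/
theorem semilocNK_cycLayerScalarO (n k : ℕ) (c : padicCoeffIntegers S) (y : cycLayerCohO S κ θ' P n k 1) :
    semilocNK S κ θ' P w n k (cycLayerScalarO S κ θ' P n k 1 c y) =
      cohomologyMap ((TopRep.resFunctor (resGalOfEmb (closureEmb (K := K) (w.adicCompletion K)) :
          absoluteGaloisGroup (w.adicCompletion K) →* absoluteGaloisGroup K)).map
        (coindFinMap (coeffHomK S θ' P (oMuScalar S (p ^ k) c) (oMuScalar_muTwistO S θ' k c)) (κ.layerSubgroup n))) 1 (semilocNK S κ θ' P w n k y) :=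
  semilocNK_levelMapHomO S κ θ' P w (oMuScalar S (p ^ k) c) (oMuScalar_muTwistO S θ' k c) n y

/-- ★★ **SEMILOCAL VANISHING = VANISHING AT EVERY PLACE ABOVE `w`**: `sloc_{w,n,k} y = 0` iff `loc_{n,w}(conj_δ y) = 0` for every `δ ∈ Γ_K` (the conjugates `loc_{n,w} ∘ conj_δ` enumerate the
localisations at the places of `K_n` above `w`; tree `map_restrict_eq_zero_iff_forall_conjMap_one` + R4's `conjMap_inflNK`, `map_comapSubtypeHom_inflNK`).
[cite: NeukirchSchmidtWingberg2008, I §5 (1.5.6)–(1.5.7), I §6 (1.6.4)–(1.6.5)] [cite: SerreLocalFields1979, VII §5] -/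
theorem semilocNK_eq_zero_iff (n k : ℕ) (y : cycLayerCohO S κ θ' P n k 1) :
    semilocNK S κ θ' P w n k y = 0 ↔ ∀ δ : absoluteGaloisGroup K, locNK S κ θ' P w n k (cycLayerConjO S κ θ' P n k 1 δ y) = 0 := by
  haveI : CompactSpace (absoluteGaloisGroup (w.adicCompletion K)) := absoluteGaloisGroup_compactSpace (w.adicCompletion K)
  rw [semilocNK_apply, semilocRes_apply, map_restrict_eq_zero_iff_forall_conjMap_one _ _ (κ.isOpen_layerSubgroup n)]
  simp only [AddEquiv.apply_symm_apply, conjMap_inflNK, map_comapSubtypeHom_inflNK]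
  exact Iff.rfl

/-! ## §4. Corestriction = fibre sum, and the strict sets through the semilocalisations -/

/-- ★ **`sloc_n ∘ cor_{K_{n+1}/K_n} = H¹(Σ_{U_{n+1}→U_n}|_{res_w}) ∘ sloc_{n+1}`**: the corestriction of honda's layer classes becomes the FIBRE SUM `coindFinSum` of the coinduced
coefficients (all places above `w` mixed in one map — the double-coset bookkeeping is inside `coindFinSum`). Needs `N_P ≤ U_{n+1}` (R4/H6: `inflNK_cycLayerCoresO`) and Shapiro
(`cohomologyMap_coindFinSum_shapiroLift`). The `Fintype` instances are arbitrary. [cite: NeukirchSchmidtWingberg2008, I §5 Prop. 1.5.4, (1.5.6)–(1.5.7), I §6 Prop. (1.6.4)] [cite: Rubin2000, App. B.3] -/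
theorem semilocNK_cycLayerCoresO (hNP : ∀ n, ramificationSubgroup K P ≤ κ.layerSubgroup n) (n k : ℕ)
    [Fintype (absoluteGaloisGroup K ⧸ κ.layerSubgroup n)] [Fintype (absoluteGaloisGroup K ⧸ κ.layerSubgroup (n + 1))]
    [Fintype (↥(κ.layerSubgroup n) ⧸ (κ.layerSubgroup (n + 1)).subgroupOf (κ.layerSubgroup n))] (y : cycLayerCohO S κ θ' P (n + 1) k 1) :
    semilocNK S κ θ' P w n k (cycLayerCoresO S κ θ' P n k 1 y) =
      cohomologyMap ((TopRep.resFunctor (resGalOfEmb (closureEmb (K := K) (w.adicCompletion K)) :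
          absoluteGaloisGroup (w.adicCompletion K) →* absoluteGaloisGroup K)).map
        (coindFinSum (coeffRepK S θ' P k).toTopRep (κ.layerSubgroup_antitone (Nat.le_succ n)))) 1 (semilocNK S κ θ' P w (n + 1) k y) := by
  obtain ⟨s, hs, hs1⟩ := exists_reps_one (G := absoluteGaloisGroup K) (κ.layerSubgroup n)
  obtain ⟨s', hs', hs'1⟩ := exists_reps_one (G := absoluteGaloisGroup K) (κ.layerSubgroup (n + 1))
  rw [semilocNK_eq_map_shapiroLift S κ θ' P w n k hs hs1, semilocNK_eq_map_shapiroLift S κ θ' P w (n + 1) k hs' hs'1,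
    inflNK_cycLayerCoresO S κ θ' P hNP n k y,
    ← cohomologyMap_coindFinSum_shapiroLift (coeffRepK S θ' P k).toTopRep (κ.layerSubgroup_antitone (Nat.le_succ n)) (κ.isOpen_layerSubgroup n)
      (κ.isOpen_layerSubgroup (n + 1)) hs hs1 hs' hs'1, ← semilocRes_apply, ← semilocRes_apply, semilocRes_cohomologyMap]

/-- `sloc` along all `n′ ≤ n` (iterated corestrictions): vanishing at level `n` descends to every `n′ ≤ n`. [cite: NeukirchSchmidtWingberg2008, I §5 Prop. 1.5.4] -/
theorem semilocNK_cycCoresLE_eq_zero (hNP : ∀ n, ramificationSubgroup K P ≤ κ.layerSubgroup n)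
    [∀ n : ℕ, Fintype (absoluteGaloisGroup K ⧸ κ.layerSubgroup n)] [∀ n : ℕ, Fintype (↥(κ.layerSubgroup n) ⧸ (κ.layerSubgroup (n + 1)).subgroupOf (κ.layerSubgroup n))]
    {n n' : ℕ} (h : n' ≤ n) (k : ℕ) {y : cycLayerCohO S κ θ' P n k 1} (hy : semilocNK S κ θ' P w n k y = 0) :
    semilocNK S κ θ' P w n' k (cycCoresLE S κ θ' P 1 h k y) = 0 := by
  induction n, h using Nat.le_induction with
  | base => rwa [cycCoresLE_refl]
  | succ m h ih =>
    rw [← cycCoresLE_trans S κ θ' P 1 h (Nat.le_succ m), cycCoresLE_succ]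
    refine ih ?_
    rw [semilocNK_cycLayerCoresO S κ θ' P w hNP m k y, hy, map_zero]

/-- ★★ **g22's STRICT SET THROUGH THE SEMILOCALISATIONS (definitional form)**: `y ∈ strictLevel S κ θ′ P S₀ n k` iff `sloc_{w,n′,k}(cor_{n→n′} y) = 0` for all `n′ ≤ n` and all `w ∈ S₀`
(`mem_strictLevel_iff` + `semilocNK_eq_zero_iff`; no hypothesis). [cite: NeukirchSchmidtWingberg2008, (8.6.2)–(8.6.3)] [cite: Rubin2000, App. B.3] -/
theorem mem_strictLevel_iff_forall_semilocNK_cycCoresLE_eq_zero (S₀ : Set (HeightOneSpectrum (𝓞 K))) (n k : ℕ) (y : cycLayerCohO S κ θ' P n k 1) :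
    y ∈ strictLevel S κ θ' P S₀ n k ↔
      ∀ (n' : ℕ) (h : n' ≤ n), ∀ w ∈ S₀, semilocNK S κ θ' P w n' k (cycCoresLE S κ θ' P 1 h k y) = 0 := by
  rw [mem_strictLevel_iff]
  refine forall_congr' fun n' ↦ forall_congr' fun h ↦ forall_congr' fun w ↦ forall_congr' fun _ ↦ ?_
  rw [semilocNK_eq_zero_iff]

/-- ★★ **g22's STRICT SET = THE CLASSES WHOSE SEMILOCALISATIONS AT `S₀` VANISH** (when `N_P ≤ U_m` for all `m`, so that corestriction = fibre sum): `y ∈ strictLevel S κ θ′ P S₀ n k ↔ ∀ w ∈ S₀,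
sloc_{w,n,k} y = 0` — the kernel of the semilocalisation `I.H → ⊕_{w∈S₀} Lloc_w` at level `(n,k)` IS the strict set; the limit statement `ker(sloc) = B′` follows levelwise.
[cite: NeukirchSchmidtWingberg2008, (8.6.2)–(8.6.3), I §5 Prop. 1.5.4] [cite: Rubin2000, Thm. 1.7.3, App. B.3] [cite: Kato2004Asterisque, §17.13] -/
theorem mem_strictLevel_iff_forall_semilocNK_eq_zero (hNP : ∀ n, ramificationSubgroup K P ≤ κ.layerSubgroup n)
    [∀ n : ℕ, Fintype (absoluteGaloisGroup K ⧸ κ.layerSubgroup n)] [∀ n : ℕ, Fintype (↥(κ.layerSubgroup n) ⧸ (κ.layerSubgroup (n + 1)).subgroupOf (κ.layerSubgroup n))]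
    (S₀ : Set (HeightOneSpectrum (𝓞 K))) (n k : ℕ) (y : cycLayerCohO S κ θ' P n k 1) :
    y ∈ strictLevel S κ θ' P S₀ n k ↔ ∀ w ∈ S₀, semilocNK S κ θ' P w n k y = 0 := by
  rw [mem_strictLevel_iff_forall_semilocNK_cycCoresLE_eq_zero]
  constructor
  · intro h w hw
    simpa only [cycCoresLE_refl] using h n le_rfl w hw
  · intro h n' hn' w hw
    exact semilocNK_cycCoresLE_eq_zero S κ θ' P w hNP hn' k (h w hw)

end Semiloc

end Summit.BirchSwinnertonDyer.BirchSwinnertonDyer.Theorems.SmallImageRttD2Seq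

end
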